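import Summits.ResolutionOfSingularities.ResolutionOfSingularities.Theorems.EquisingularLiftEquisingularLiftNatChainStep
import Summits.ResolutionOfSingularities.ResolutionOfSingularities.Theorems.EquisingularLiftEquisingularLiftHorizChainSectionStep
import HarnessLib

/-!
# [OURS · L1 W4.5(b)] EL♮ `EquisingularLiftNat` (stmt-ResolutionOfSingularities-20038), line `sections` (skeleton v2) —
# HORIZONTAL E1 CHAINS: the closure toolkit and the SECTION DEVICE in lead-2's currency

Helper file `--supports stmt-ResolutionOfSingularities-20038` (unit w45b-stub-6 «T_sec», after-care for the lead-2 reshape of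
2026-08-27: registered research stub `stub_elnat_three_horiz`, DEVICE CURRENCY «a device lemma ends in ONE HorizChainE1 step =
⟨IsBlowup τ C, IsRegular V(C), Flat (V(C) ↪ X' → Spec O), image off the generic point of Y, E1⟩»). NOT a statement of any
manuscript; OURS plumbing, companion of `…NatSectionStep` (p497593), `…NatChainStep` (p499551) and `…NatHorizChain` (p500485).

The HORIZONTAL E1 closure («HorizChainE1») of `(P, 𝟙, Y)` w.r.t. a base `q : P → Spec O` is the E1 closure of the item
(`…NatChainStep`) with ONE more step hypothesis, flatness of the centre over `Spec O`:
a stage `(X₁, σ₁, Y₁)` passes to `(X₂, τ ≫ σ₁, closure (τ⁻¹(Y₁ ∖ supp C)))` for a blow-up `τ : X₂ → X₁` along `C` provided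
(i) `V(C)` is regular, (ii) `V(C) ↪ X₁ → P → Spec O` is FLAT, (iii) `σ₁(supp C)` contains no generic point of `Y`,
(iv) E1: `supp C ∩ (σ₁ ≫ q)⁻¹{s₀} ⊆ Y₁`. This file records, INLINE in that vocabulary and for a general base `q`
(instantiate `P := Proj (MvPolynomial.homogeneousSubmodule (Fin (n+1)) O)`,
`q := Proj.toSpecZero _ ≫ Spec.map (CommRingCat.ofHom (algebraMap O (_ 0)))` to get the registered stub's clause syntactically):

* `horizChainE1_nil` — the empty chain;
* `natChain_of_horizChainE1` — FORGET FLATNESS (hypothesis-free): a horizontal E1 chain is an E1 chain of the item; with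
  `chain_of_natChain` this gives `chain_of_horizChainE1 : … → Split.Chain P Y P' σ S'`, so `Chain.fibre`, `chain_isRegular`,
  `closure_subset_preimage_of_chain`, `Chain.comp` … apply to horizontal E1 chains;
* `horizChainE1_step` — ONE GENERAL STEP (`Y = closure {ξ}`): blow-up along a regular, `O`-flat centre `C` with E1 and
  `¬ Y₁ ⊆ supp C`; `horizChainE1_step_of_ssubset` — the same from «special support of `C` ⊂ Y₁» (proper subset);
* `horizChainE1_comp` — horizontal E1 chains compose;
* `flat_kerSubschemeι_comp_of_section` — for a section `s` of `r : X → Spec O` (`O` a DVR, `r` separated) the centre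
  `V(ker s) ↪ X → Spec O` is flat (it is the inverse of the isomorphism `s.toImage : Spec O ≅ V(ker s)`);
* `horizChainE1_section_step` — THE SECTION DEVICE: a Hensel-section centre `ker s` with `s(s₀) ∈ Y₁` and `σ₁ (s s₀)` not
  generic in `Y` is ONE HorizChainE1 step (regular: p167199; flat: above; off-generic and E1: p497593).

References: Theorems/EquisingularLiftEquisingularLiftHorizChainSectionStep.lean (`StrataSplit.horizChain_section_step`, the
typed-door version with the «missed point» clause), L/w45b/EL-NATURAL/SkeletonELnat-v2.lean, res-L1-w45b-lead-2 STATUS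
2026-08-27T05:23:05Z (device currency).
-/

set_option linter.dupNamespace false -- mandated namespace `Summit.<Summit>.<Problem>` of this single-conjunct summit
set_option linter.overlappingInstances false -- signatures carry `[IsDomain O] [IsDiscreteValuationRing O]`

noncomputable section

open CategoryTheory CategoryTheory.Limits AlgebraicGeometry TopologicalSpace Topology
open Literature.AlgebraicGeometry.Resolution
open Summit.ResolutionOfSingularities.ResolutionOfSingularities.Theses.EquisingularLift.Split
open Summit.ResolutionOfSingularities.ResolutionOfSingularities.Cruxes.EquisingularLift.StrataSplit

namespace Summit.ResolutionOfSingularities.ResolutionOfSingularities.Cruxes.EquisingularLiftNat.Sections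

/-! ## The closure: nil, forget, one step, composition -/

/-- **The empty horizontal E1 chain** `(P, 𝟙, Y)`. [folklore] -/
theorem horizChainE1_nil {O : Type} [CommRing O] [IsLocalRing O] {P : AlgebraicGeometry.Scheme.{0}} (q : P ⟶ AlgebraicGeometry.Spec (.of O)) (Y : Set P) :
    ∀ Q : (∀ X' : AlgebraicGeometry.Scheme.{0}, (X' ⟶ P) → Set X' → Prop), Q P (CategoryTheory.CategoryStruct.id _) Y → (∀ (X' X'' : AlgebraicGeometry.Scheme.{0}) (σ' : X' ⟶ P) (Y' : Set X') (C : X'.IdealSheafData) (τ : X'' ⟶ X'), Q X' σ' Y' → Literature.AlgebraicGeometry.Resolution.IsBlowup τ C → Literature.AlgebraicGeometry.Resolution.Scheme.IsRegular C.subscheme → AlgebraicGeometry.Flat (CategoryTheory.CategoryStruct.comp C.subschemeι (CategoryTheory.CategoryStruct.comp σ' q)) → σ' '' (C.support : Set X') ⊆ {x | ¬ IsGenericPoint x Y} → (C.support : Set X') ∩ (CategoryTheory.CategoryStruct.comp σ' q) ⁻¹' {IsLocalRing.closedPoint O} ⊆ Y' → Q X'' (CategoryTheory.CategoryStruct.comp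 τ σ') (closure (τ ⁻¹' (Y' \ (C.support : Set X'))))) → Q P (CategoryTheory.CategoryStruct.id _) Y :=
  fun _ h0 _ => h0

/-- **FORGET FLATNESS: a horizontal E1 chain is an E1 chain of the item** (hypothesis-free): a predicate closed under ALL
regular-centre E1 steps over non-generic points of `Y` is in particular closed under the `O`-flat ones. [folklore] -/
theorem natChain_of_horizChainE1 {O : Type} [CommRing O] [IsLocalRing O] {P : AlgebraicGeometry.Scheme.{0}} (q : P ⟶ AlgebraicGeometry.Spec (.of O)) (Y : Set P) {P' : AlgebraicGeometry.Scheme.{0}} (σ : P' ⟶ P) (S' : Set P') (h : ∀ Q : (∀ X' : AlgebraicGeometry.Scheme.{0}, (X' ⟶ P) → Set X' → Prop), Q P (CategoryTheory.CategoryStruct.id _) Y → (∀ (X' X'' : AlgebraicGeometry.Scheme.{0}) (σ' : X' ⟶ P) (Y' : Set X') (C : X'.IdealSheafData) (τ : X'' ⟶ X'), Q X' σ' Y' → Literature.AlgebraicGeometry.Resolution.IsBlowup τ C → Literature.AlgebraicGeometry.Resolution.Scheme.IsRegular C.subscheme → AlgebraicGeometry.Flat (CategoryTheory.CategoryStruct.comp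 C.subschemeι (CategoryTheory.CategoryStruct.comp σ' q)) → σ' '' (C.support : Set X') ⊆ {x | ¬ IsGenericPoint x Y} → (C.support : Set X') ∩ (CategoryTheory.CategoryStruct.comp σ' q) ⁻¹' {IsLocalRing.closedPoint O} ⊆ Y' → Q X'' (CategoryTheory.CategoryStruct.comp τ σ') (closure (τ ⁻¹' (Y' \ (C.support : Set X'))))) → Q P' σ S') :
    ∀ Q : (∀ X' : AlgebraicGeometry.Scheme.{0}, (X' ⟶ P) → Set X' → Prop), Q P (CategoryTheory.CategoryStruct.id _) Y → (∀ (X' X'' : AlgebraicGeometry.Scheme.{0}) (σ' : X' ⟶ P) (Y' : Set X') (C : X'.IdealSheafData) (τ : X'' ⟶ X'), Q X' σ' Y' → Literature.AlgebraicGeometry.Resolution.IsBlowup τ C → Literature.AlgebraicGeometry.Resolution.Scheme.IsRegular C.subscheme → σ' '' (C.support : Set X') ⊆ {x | ¬ IsGenericPoint x Y} → (C.support : Set X') ∩ (CategoryTheory.CategoryStruct.comp σ' q) ⁻¹' {IsLocalRing.closedPoint O} ⊆ Y' → Q X'' (CategoryTheory.CategoryStruct.comp τ σ') (closure (τ ⁻¹'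 (Y' \ (C.support : Set X'))))) → Q P' σ S' :=
  fun Q h0 hstep => h Q h0 (fun X' X'' σ' Y' C τ hQ hτ hC _ himg hE1 => hstep X' X'' σ' Y' C τ hQ hτ hC himg hE1)

/-- **A horizontal E1 chain is a chain** (`Split.Chain`), so `Chain.fibre`, `chain_isRegular`, `closure_subset_preimage_of_chain`,
`Chain.comp`, … apply. [folklore] -/
theorem chain_of_horizChainE1 {O : Type} [CommRing O] [IsLocalRing O] {P : AlgebraicGeometry.Scheme.{0}} (q : P ⟶ AlgebraicGeometry.Spec (.of O)) (Y : Set P) {P' : AlgebraicGeometry.Scheme.{0}} (σ : P' ⟶ P) (S' : Set P') (h : ∀ Q : (∀ X' : AlgebraicGeometry.Scheme.{0}, (X' ⟶ P) → Set X' → Prop), Q P (CategoryTheory.CategoryStruct.id _) Y → (∀ (X' X'' : AlgebraicGeometry.Scheme.{0}) (σ' : X' ⟶ P) (Y' : Set X') (C : X'.IdealSheafData) (τ : X'' ⟶ X'), Q X' σ' Y' → Literature.AlgebraicGeometry.Resolution.IsBlowup τ C → Literature.AlgebraicGeometry.Resolution.Scheme.IsRegular C.subscheme → AlgebraicGeometry.Flat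 (CategoryTheory.CategoryStruct.comp C.subschemeι (CategoryTheory.CategoryStruct.comp σ' q)) → σ' '' (C.support : Set X') ⊆ {x | ¬ IsGenericPoint x Y} → (C.support : Set X') ∩ (CategoryTheory.CategoryStruct.comp σ' q) ⁻¹' {IsLocalRing.closedPoint O} ⊆ Y' → Q X'' (CategoryTheory.CategoryStruct.comp τ σ') (closure (τ ⁻¹' (Y' \ (C.support : Set X'))))) → Q P' σ S') :
    Chain P Y P' σ S' :=
  chain_of_natChain q Y σ S' (natChain_of_horizChainE1 q Y σ S' h)

/-- **ONE GENERAL HORIZONTAL E1 STEP.** Let `Y = closure {ξ} ⊆ P`, `(X₁, σ₁, Y₁)` a horizontal E1 chain over `(P, Y)` w.r.t.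
`q : P → Spec O`, `τ : X₂ → X₁` a blow-up along an ideal sheaf `C` with `V(C)` regular and `V(C) ↪ X₁ → P → Spec O` flat, whose
special support lies in `Y₁` (E1) and which does not contain all of `Y₁`. Then `(X₂, τ ≫ σ₁, closure (τ⁻¹(Y₁ ∖ supp C)))` is a
horizontal E1 chain over `(P, Y)`: the only point of `X₁` over `ξ` is the generic point `ξ₁` of `Y₁ = closure {ξ₁}`
(`Chain.fibre`), and `ξ₁ ∈ supp C` would force `Y₁ ⊆ supp C`. Covers Δ-centres (`deltaFlat`), combs, sub-lifts and sections.
[folklore] -/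
theorem horizChainE1_step {O : Type} [CommRing O] [IsLocalRing O] {P : AlgebraicGeometry.Scheme.{0}} (q : P ⟶ AlgebraicGeometry.Spec (.of O)) {Y : Set P} {ξ : P} (hξ : IsGenericPoint ξ Y) {X₁ X₂ : AlgebraicGeometry.Scheme.{0}} {σ₁ : X₁ ⟶ P} {Y₁ : Set X₁} (h₁ : ∀ Q : (∀ X' : AlgebraicGeometry.Scheme.{0}, (X' ⟶ P) → Set X' → Prop), Q P (CategoryTheory.CategoryStruct.id _) Y → (∀ (X' X'' : AlgebraicGeometry.Scheme.{0}) (σ' : X' ⟶ P) (Y' : Set X') (C : X'.IdealSheafData) (τ : X'' ⟶ X'), Q X' σ' Y' → Literature.AlgebraicGeometry.Resolution.IsBlowup τ C → Literature.AlgebraicGeometry.Resolution.Scheme.IsRegular C.subscheme → AlgebraicGeometry.Flat (CategoryTheory.CategoryStruct.comp C.subschemeι (CategoryTheory.CategoryStruct.comp σ' q)) → σ' '' (C.support : Set X') ⊆ {x | ¬ IsGenericPoint x Y} → (C.support : Set X') ∩ (CategoryTheory.CategoryStruct.comp σ' q) ⁻¹' {IsLocalRing.closedPoint O} ⊆ Y'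 → Q X'' (CategoryTheory.CategoryStruct.comp τ σ') (closure (τ ⁻¹' (Y' \ (C.support : Set X'))))) → Q X₁ σ₁ Y₁) {C : X₁.IdealSheafData} {τ : X₂ ⟶ X₁} (hτ : Literature.AlgebraicGeometry.Resolution.IsBlowup τ C) (hC : Literature.AlgebraicGeometry.Resolution.Scheme.IsRegular C.subscheme) (hflat : AlgebraicGeometry.Flat (CategoryTheory.CategoryStruct.comp C.subschemeι (CategoryTheory.CategoryStruct.comp σ₁ q))) (hE1 : (C.support : Set X₁) ∩ (CategoryTheory.CategoryStruct.comp σ₁ q) ⁻¹' {IsLocalRing.closedPoint O} ⊆ Y₁) (hne : ¬ Y₁ ⊆ (C.support : Set X₁)) :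
    ∀ Q : (∀ X' : AlgebraicGeometry.Scheme.{0}, (X' ⟶ P) → Set X' → Prop), Q P (CategoryTheory.CategoryStruct.id _) Y → (∀ (X' X'' : AlgebraicGeometry.Scheme.{0}) (σ' : X' ⟶ P) (Y' : Set X') (C : X'.IdealSheafData) (τ : X'' ⟶ X'), Q X' σ' Y' → Literature.AlgebraicGeometry.Resolution.IsBlowup τ C → Literature.AlgebraicGeometry.Resolution.Scheme.IsRegular C.subscheme → AlgebraicGeometry.Flat (CategoryTheory.CategoryStruct.comp C.subschemeι (CategoryTheory.CategoryStruct.comp σ' q)) → σ' '' (C.support : Set X') ⊆ {x | ¬ IsGenericPoint x Y} → (C.support : Set X') ∩ (CategoryTheory.CategoryStruct.comp σ' q) ⁻¹' {IsLocalRing.closedPoint O} ⊆ Y' → Q X'' (CategoryTheory.CategoryStruct.comp τ σ') (closure (τ ⁻¹' (Y' \ (C.support : Set X'))))) → Q X₂ (CategoryTheory.CategoryStruct.comp τ σ₁) (closure (τ ⁻¹' (Y₁ \ (C.support : Set X₁)))) := by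
  -- adapted from `natChain_step` (Theorems/EquisingularLiftEquisingularLiftNatChainStep.lean)
  obtain ⟨ξ₁, hfib, hY₁⟩ := (chain_of_horizChainE1 q Y σ₁ Y₁ h₁).fibre hξ
  have himg : σ₁ '' (C.support : Set X₁) ⊆ {x : P | ¬ IsGenericPoint x Y} := by
    rintro _ ⟨c, hc, rfl⟩ hgen
    have h1 : σ₁ c = ξ := hgen.eq hξ
    have h2 : c = ξ₁ := by
      have : c ∈ σ₁ ⁻¹' {ξ} := h1
      rw [hfib] at this
      simpa using this
    subst h2
    apply hne
    rw [hY₁]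
    exact closure_minimal (Set.singleton_subset_iff.mpr hc) C.support.isClosed
  intro Q h0 hstep
  exact hstep X₁ X₂ σ₁ Y₁ C τ (h₁ Q h0 hstep) hτ hC hflat himg hE1

/-- **ONE GENERAL HORIZONTAL E1 STEP, proper-subset form.** As `horizChainE1_step`, with «off the generic point» ∧ E1 replaced
by the single hypothesis «the special support of the centre is a PROPER subset of `Y₁`»: `Y₁` lies in the special fibre
(`Y` irreducible, closed, inside the special fibre), so `Y₁ ⊆ supp C` would make the special support of `C` equal to `Y₁`.
[folklore] -/
theorem horizChainE1_step_of_ssubset {O : Type} [CommRing O] [IsLocalRing O] {P : AlgebraicGeometry.Scheme.{0}} (q : P ⟶ AlgebraicGeometry.Spec (.of O)) {Y : Set P} (hYirr : IsIrreducible Y) (hYcl : IsClosed Y) (hY : Y ⊆ q ⁻¹' {IsLocalRing.closedPoint O}) {X₁ X₂ : AlgebraicGeometry.Scheme.{0}} {σ₁ : X₁ ⟶ P} {Y₁ : Set X₁} (h₁ : ∀ Q : (∀ X' : AlgebraicGeometry.Scheme.{0}, (X' ⟶ P) → Set X' → Prop), Q P (CategoryTheory.CategoryStruct.id _) Y → (∀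 (X' X'' : AlgebraicGeometry.Scheme.{0}) (σ' : X' ⟶ P) (Y' : Set X') (C : X'.IdealSheafData) (τ : X'' ⟶ X'), Q X' σ' Y' → Literature.AlgebraicGeometry.Resolution.IsBlowup τ C → Literature.AlgebraicGeometry.Resolution.Scheme.IsRegular C.subscheme → AlgebraicGeometry.Flat (CategoryTheory.CategoryStruct.comp C.subschemeι (CategoryTheory.CategoryStruct.comp σ' q)) → σ' '' (C.support : Set X') ⊆ {x | ¬ IsGenericPoint x Y} → (C.support : Set X') ∩ (CategoryTheory.CategoryStruct.comp σ' q) ⁻¹' {IsLocalRing.closedPoint O} ⊆ Y' → Q X'' (CategoryTheory.CategoryStruct.comp τ σ') (closure (τ ⁻¹' (Y' \ (C.support : Set X'))))) → Q X₁ σ₁ Y₁) {C : X₁.IdealSheafData} {τ : X₂ ⟶ X₁} (hτ : Literature.AlgebraicGeometry.Resolution.IsBlowup τ C) (hC : Literature.AlgebraicGeometry.Resolution.Scheme.IsRegular C.subscheme) (hflat : AlgebraicGeometry.Flat (CategoryTheory.CategoryStruct.comp C.subschemeι (CategoryTheory.CategoryStruct.comp σ₁ q))) (hss : (C.support : Set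 X₁) ∩ (CategoryTheory.CategoryStruct.comp σ₁ q) ⁻¹' {IsLocalRing.closedPoint O} ⊂ Y₁) :
    ∀ Q : (∀ X' : AlgebraicGeometry.Scheme.{0}, (X' ⟶ P) → Set X' → Prop), Q P (CategoryTheory.CategoryStruct.id _) Y → (∀ (X' X'' : AlgebraicGeometry.Scheme.{0}) (σ' : X' ⟶ P) (Y' : Set X') (C : X'.IdealSheafData) (τ : X'' ⟶ X'), Q X' σ' Y' → Literature.AlgebraicGeometry.Resolution.IsBlowup τ C → Literature.AlgebraicGeometry.Resolution.Scheme.IsRegular C.subscheme → AlgebraicGeometry.Flat (CategoryTheory.CategoryStruct.comp C.subschemeι (CategoryTheory.CategoryStruct.comp σ' q)) → σ' '' (C.support : Set X') ⊆ {x | ¬ IsGenericPoint x Y} → (C.support : Set X') ∩ (CategoryTheory.CategoryStruct.comp σ' q) ⁻¹' {IsLocalRing.closedPoint O} ⊆ Y' → Q X'' (CategoryTheory.CategoryStruct.comp τ σ') (closure (τ ⁻¹' (Y' \ (C.support : Set X'))))) → Q X₂ (CategoryTheory.CategoryStruct.comp τ σ₁) (closure (τ ⁻¹' (Y₁ \ (C.support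 : Set X₁)))) := by
  -- adapted from `natChain_step_of_ssubset` (Theorems/EquisingularLiftEquisingularLiftNatChainStep.lean)
  obtain ⟨ξ, hξ⟩ : ∃ ξ : P, IsGenericPoint ξ Y := QuasiSober.sober hYirr hYcl
  have hch : Chain P Y X₁ σ₁ Y₁ := chain_of_horizChainE1 q Y σ₁ Y₁ h₁
  obtain ⟨ξ₁, hfib, hY₁⟩ := hch.fibre hξ
  have hσξ₁ : σ₁ ξ₁ = ξ := by
    have : ξ₁ ∈ σ₁ ⁻¹' {ξ} := by rw [hfib]; rfl
    simpa using this
  have hsub : Y₁ ⊆ (CategoryTheory.CategoryStruct.comp σ₁ q) ⁻¹' {IsLocalRing.closedPoint O} := by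
    have hcl : IsClosed ((σ₁ ≫ q) ⁻¹' {IsLocalRing.closedPoint O}) :=
      (IsLocalRing.isClosed_singleton_closedPoint O).preimage (σ₁ ≫ q).continuous
    rw [hY₁]
    refine closure_minimal (Set.singleton_subset_iff.mpr ?_) hcl
    show (σ₁ ≫ q) ξ₁ ∈ ({IsLocalRing.closedPoint O} : Set _)
    rw [Scheme.Hom.comp_apply, hσξ₁]
    exact hY hξ.mem
  refine horizChainE1_step q hξ h₁ hτ hC hflat hss.le fun hle => hss.ne ?_
  exact Set.Subset.antisymm hss.le (Set.subset_inter hle hsub)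

/-- **Horizontal E1 chains compose** (as `Split.Chain.comp` / `natChain_comp`). Let `Y = closure {ξ}`. A horizontal E1 chain
`(P₁, σ₁, S₁)` over `(P, Y)` w.r.t. `q`, followed by a horizontal E1 chain `(P₂, σ₂, S₂)` over `(P₁, closure S₁)` w.r.t. `σ₁ ≫ q`,
is a horizontal E1 chain `(P₂, σ₂ ≫ σ₁, S₂)` over `(P, Y)` w.r.t. `q` (off-generic via `Chain.fibre`; flatness and E1 are the same
clauses up to reassociating `(τ ≫ σ₁) ≫ q = τ ≫ (σ₁ ≫ q)`). [folklore] -/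
theorem horizChainE1_comp {O : Type} [CommRing O] [IsLocalRing O] {P : AlgebraicGeometry.Scheme.{0}} (q : P ⟶ AlgebraicGeometry.Spec (.of O)) {Y : Set P} {ξ : P} (hξ : IsGenericPoint ξ Y) {P₁ : AlgebraicGeometry.Scheme.{0}} {σ₁ : P₁ ⟶ P} {S₁ : Set P₁} (h₁ : ∀ Q : (∀ X' : AlgebraicGeometry.Scheme.{0}, (X' ⟶ P) → Set X' → Prop), Q P (CategoryTheory.CategoryStruct.id _) Y → (∀ (X' X'' : AlgebraicGeometry.Scheme.{0}) (σ' : X' ⟶ P) (Y' : Set X') (C : X'.IdealSheafData) (τ : X'' ⟶ X'), Q X' σ' Y' → Literature.AlgebraicGeometry.Resolution.IsBlowup τ C → Literature.AlgebraicGeometry.Resolution.Scheme.IsRegular C.subscheme → AlgebraicGeometry.Flat (CategoryTheory.CategoryStruct.comp C.subschemeι (CategoryTheory.CategoryStruct.comp σ' q)) → σ' '' (C.support : Set X') ⊆ {x | ¬ IsGenericPoint x Y} → (C.support : Set X') ∩ (CategoryTheory.CategoryStruct.comp σ' q) ⁻¹' {IsLocalRing.closedPoint O} ⊆ Y' → Q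 X'' (CategoryTheory.CategoryStruct.comp τ σ') (closure (τ ⁻¹' (Y' \ (C.support : Set X'))))) → Q P₁ σ₁ S₁) {P₂ : AlgebraicGeometry.Scheme.{0}} {σ₂ : P₂ ⟶ P₁} {S₂ : Set P₂} (h₂ : ∀ Q : (∀ X' : AlgebraicGeometry.Scheme.{0}, (X' ⟶ P₁) → Set X' → Prop), Q P₁ (CategoryTheory.CategoryStruct.id _) (closure S₁) → (∀ (X' X'' : AlgebraicGeometry.Scheme.{0}) (σ' : X' ⟶ P₁) (Y' : Set X') (C : X'.IdealSheafData) (τ : X'' ⟶ X'), Q X' σ' Y' → Literature.AlgebraicGeometry.Resolution.IsBlowup τ C → Literature.AlgebraicGeometry.Resolution.Scheme.IsRegular C.subscheme → AlgebraicGeometry.Flat (CategoryTheory.CategoryStruct.comp C.subschemeι (CategoryTheory.CategoryStruct.comp σ' (CategoryTheory.CategoryStruct.comp σ₁ q))) → σ' '' (C.support : Set X') ⊆ {x | ¬ IsGenericPoint x (closure S₁)} → (C.support : Set X') ∩ (CategoryTheory.CategoryStruct.comp σ' (CategoryTheory.CategoryStruct.comp σ₁ q)) ⁻¹' {IsLocalRing.closedPoint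 O} ⊆ Y' → Q X'' (CategoryTheory.CategoryStruct.comp τ σ') (closure (τ ⁻¹' (Y' \ (C.support : Set X'))))) → Q P₂ σ₂ S₂) :
    ∀ Q : (∀ X' : AlgebraicGeometry.Scheme.{0}, (X' ⟶ P) → Set X' → Prop), Q P (CategoryTheory.CategoryStruct.id _) Y → (∀ (X' X'' : AlgebraicGeometry.Scheme.{0}) (σ' : X' ⟶ P) (Y' : Set X') (C : X'.IdealSheafData) (τ : X'' ⟶ X'), Q X' σ' Y' → Literature.AlgebraicGeometry.Resolution.IsBlowup τ C → Literature.AlgebraicGeometry.Resolution.Scheme.IsRegular C.subscheme → AlgebraicGeometry.Flat (CategoryTheory.CategoryStruct.comp C.subschemeι (CategoryTheory.CategoryStruct.comp σ' q)) → σ' '' (C.support : Set X') ⊆ {x | ¬ IsGenericPoint x Y} → (C.support : Set X') ∩ (CategoryTheory.CategoryStruct.comp σ' q) ⁻¹' {IsLocalRing.closedPoint O} ⊆ Y' → Q X'' (CategoryTheory.CategoryStruct.comp τ σ') (closure (τ ⁻¹' (Y' \ (C.support : Set X'))))) → Q P₂ (CategoryTheory.CategoryStruct.comp σ₂ σ₁)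 S₂ := by
  -- adapted from `natChain_comp` (Theorems/EquisingularLiftEquisingularLiftNatSectionStep.lean)
  obtain ⟨ξ₁, hfib, hS₁⟩ := (chain_of_horizChainE1 q Y σ₁ S₁ h₁).fibre hξ
  have hS₁cl : closure S₁ = S₁ := by rw [hS₁, closure_closure]
  have hgen₁ : IsGenericPoint ξ₁ (closure S₁) := by
    rw [isGenericPoint_def, hS₁, closure_closure]
  intro Q hbase hstep
  have hQ₁ : Q P₁ σ₁ S₁ := h₁ Q hbase hstep
  refine h₂ (fun X' τ T => Q X' (CategoryStruct.comp τ σ₁) T) ?_ ?_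
  · simpa [hS₁cl] using hQ₁
  · intro X' X'' τ T C τ' hQ hτ' hC hflat hTC hE1
    have key : (CategoryStruct.comp τ σ₁) '' (C.support : Set X') ⊆ {x : P | ¬ IsGenericPoint x Y} := by
      rintro _ ⟨c, hc, rfl⟩ hgen
      have h1 : σ₁ (τ c) = ξ := by
        rw [← Scheme.Hom.comp_apply]
        exact hgen.eq hξ
      have h2 : τ c = ξ₁ := by
        have : τ c ∈ σ₁ ⁻¹' {ξ} := h1
        rw [hfib] at this
        simpa using this
      exact hTC ⟨c, hc, rfl⟩ (h2 ▸ hgen₁)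
    have hflat' : Flat (CategoryStruct.comp C.subschemeι
        (CategoryStruct.comp (CategoryStruct.comp τ σ₁) q)) := by
      rw [Category.assoc]; exact hflat
    have hE1' : (C.support : Set X') ∩ (CategoryStruct.comp (CategoryStruct.comp τ σ₁) q) ⁻¹'
        {IsLocalRing.closedPoint O} ⊆ T := by
      rw [Category.assoc]; exact hE1
    have := hstep X' X'' (CategoryStruct.comp τ σ₁) T C τ' hQ hτ' hC hflat' key hE1'
    simpa [Category.assoc] using this

/-! ## The section device -/

/-- **Section centres are `O`-flat.** For a DVR `O`, a separated `r : X → Spec O` and a section `s` of `r`, the composite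
`V(ker s) ↪ X → Spec O` is flat: `s` is a closed immersion (p167199), so `s.toImage : Spec O ⟶ V(ker s)` is an isomorphism and
the composite is its inverse. [folklore] -/
theorem flat_kerSubschemeι_comp_of_section (O : Type) [CommRing O] [IsDomain O] [IsDiscreteValuationRing O]
    {X : Scheme.{0}} (r : X ⟶ Spec (.of O)) [IsSeparated r] (s : Spec (.of O) ⟶ X) (hs : s ≫ r = 𝟙 _) :
    Flat (s.ker.subschemeι ≫ r) := by
  -- adapted from `StrataSplit.horizChain_section_step` (Theorems/EquisingularLiftEquisingularLiftHorizChainSectionStep.lean)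
  obtain ⟨hci, -, -, -⟩ := section_isClosedImmersion_and_isRegular_ker O X r s hs
  haveI := hci
  have h1 : s.toImage ≫ (s.ker.subschemeι ≫ r) = 𝟙 _ := by
    rw [← Category.assoc, Scheme.Hom.toImage_imageι]; exact hs
  have h2 : s.ker.subschemeι ≫ r = inv s.toImage := by
    rw [← cancel_epi s.toImage, h1, IsIso.hom_inv_id]
  rw [h2]; infer_instance

/-- **THE SECTION DEVICE (one horizontal E1 step along a section).** Let `O` be a DVR, `q : P → Spec O`, `Y ⊆ P` inside the
special fibre, `(X₁, σ₁, Y₁)` a horizontal E1 chain over `(P, 𝟙, Y)` (the registered stub's clause, inlined), `σ₁ ≫ q`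
separated, `s` a section of `σ₁ ≫ q` with `s(s₀) ∈ Y₁` and `σ₁ (s s₀)` not a generic point of `Y`, and `τ₁ : X₂ → X₁` a blow-up
along `ker s`. Then `(X₂, τ₁ ≫ σ₁, closure (τ₁⁻¹(Y₁ ∖ supp ker s)))` is a horizontal E1 chain: the centre `V(ker s) ≅ Spec O` is
regular (p167199) and `O`-flat (`flat_kerSubschemeι_comp_of_section`), lies over non-generic points of `Y`
(`image_support_ker_subset_not_isGenericPoint`), and its only special point `s(s₀)` lies in `Y₁` (E1,
`support_ker_inter_preimage_closedPoint_subset`). [folklore] -/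
theorem horizChainE1_section_step : ∀ (O : Type) [CommRing O] [IsDomain O] [IsDiscreteValuationRing O] (P : AlgebraicGeometry.Scheme.{0}) (q : P ⟶ AlgebraicGeometry.Spec (.of O)) (Y : Set P) (X₁ X₂ : AlgebraicGeometry.Scheme.{0}) (σ₁ : X₁ ⟶ P) (Y₁ : Set X₁) (s : AlgebraicGeometry.Spec (.of O) ⟶ X₁) (τ₁ : X₂ ⟶ X₁) [AlgebraicGeometry.IsSeparated (CategoryTheory.CategoryStruct.comp σ₁ q)], Y ⊆ q ⁻¹' {IsLocalRing.closedPoint O} → CategoryTheory.CategoryStruct.comp s (CategoryTheory.CategoryStruct.comp σ₁ q) = CategoryTheory.CategoryStruct.id _ → Literature.AlgebraicGeometry.Resolution.IsBlowup τ₁ s.ker → s (IsLocalRing.closedPoint O) ∈ Y₁ → ¬ IsGenericPoint (σ₁ (s (IsLocalRing.closedPoint O))) Y → (∀ Q : (∀ X' : AlgebraicGeometry.Scheme.{0}, (X' ⟶ P) → Set X' → Prop), Q P (CategoryTheory.CategoryStruct.id _) Y → (∀ (X' X'' : AlgebraicGeometry.Scheme.{0}) (σ' : X' ⟶ P) (Y'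 : Set X') (C : X'.IdealSheafData) (τ : X'' ⟶ X'), Q X' σ' Y' → Literature.AlgebraicGeometry.Resolution.IsBlowup τ C → Literature.AlgebraicGeometry.Resolution.Scheme.IsRegular C.subscheme → AlgebraicGeometry.Flat (CategoryTheory.CategoryStruct.comp C.subschemeι (CategoryTheory.CategoryStruct.comp σ' q)) → σ' '' (C.support : Set X') ⊆ {x | ¬ IsGenericPoint x Y} → (C.support : Set X') ∩ (CategoryTheory.CategoryStruct.comp σ' q) ⁻¹' {IsLocalRing.closedPoint O} ⊆ Y' → Q X'' (CategoryTheory.CategoryStruct.comp τ σ') (closure (τ ⁻¹' (Y' \ (C.support : Set X'))))) → Q X₁ σ₁ Y₁) → (∀ Q : (∀ X' : AlgebraicGeometry.Scheme.{0}, (X' ⟶ P) → Set X' → Prop), Q P (CategoryTheory.CategoryStruct.id _) Y → (∀ (X' X'' : AlgebraicGeometry.Scheme.{0}) (σ' : X' ⟶ P) (Y' : Set X') (C : X'.IdealSheafData) (τ : X'' ⟶ X'), Q X' σ' Y' → Literature.AlgebraicGeometry.Resolution.IsBlowup τ C → Literature.AlgebraicGeometry.Resolution.Scheme.IsRegular C.subscheme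 → AlgebraicGeometry.Flat (CategoryTheory.CategoryStruct.comp C.subschemeι (CategoryTheory.CategoryStruct.comp σ' q)) → σ' '' (C.support : Set X') ⊆ {x | ¬ IsGenericPoint x Y} → (C.support : Set X') ∩ (CategoryTheory.CategoryStruct.comp σ' q) ⁻¹' {IsLocalRing.closedPoint O} ⊆ Y' → Q X'' (CategoryTheory.CategoryStruct.comp τ σ') (closure (τ ⁻¹' (Y' \ (C.support : Set X'))))) → Q X₂ (CategoryTheory.CategoryStruct.comp τ₁ σ₁) (closure (τ₁ ⁻¹' (Y₁ \ (s.ker.support : Set X₁))))) := by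
  intro O _ _ _ P q Y X₁ X₂ σ₁ Y₁ s τ₁ _ hY hs hτ hsY₁ hgen hH Q h0 hstep
  have hQ₁ : Q X₁ σ₁ Y₁ := hH Q h0 hstep
  obtain ⟨-, hreg, -, -⟩ := section_isClosedImmersion_and_isRegular_ker O X₁ (σ₁ ≫ q) s hs
  have hflat : Flat (s.ker.subschemeι ≫ σ₁ ≫ q) := flat_kerSubschemeι_comp_of_section O (σ₁ ≫ q) s hs
  have himg : σ₁ '' (s.ker.support : Set X₁) ⊆ {x : P | ¬ IsGenericPoint x Y} :=
    image_support_ker_subset_not_isGenericPoint O σ₁ q Y hY s hs hgen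
  have hE1 : (s.ker.support : Set X₁) ∩ (σ₁ ≫ q) ⁻¹' {IsLocalRing.closedPoint O} ⊆ Y₁ :=
    support_ker_inter_preimage_closedPoint_subset O (σ₁ ≫ q) s hs hsY₁
  exact hstep X₁ X₂ σ₁ Y₁ s.ker τ₁ hQ₁ hτ hreg hflat himg hE1

end Summit.ResolutionOfSingularities.ResolutionOfSingularities.Cruxes.EquisingularLiftNat.Sections

end
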